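import Mathlib.Data.Real.Basic
import Mathlib.Data.Fintype.Card
import Mathlib.Data.List.Nodup
import Mathlib.Data.List.Chain
import Mathlib.Data.Set.Finite.List
import Mathlib.Data.Set.Finite.Lemmas
import Mathlib.Algebra.BigOperators.Group.Finset.Piecewise
import Mathlib.Tactic.Linarith
import HarnessLib

/-!
# Difference constraints: a feasible potential yields short-walk potentials

Systems of difference constraints `π(v) - π(u) ≤ w(u, v)` (`(u, v)` ranging over the edges of a
finite digraph with real weights) are the linear-programming form of single-source shortest paths
[CLRS2009, §24.4]: the system is feasible iff the constraint graph has no negative-weight cycle, and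
then shortest-path weights are a solution (Thm 24.9); moreover a shortest walk may be taken with at
most `|V| - 1` edges, since a walk with `|V|` edges repeats a vertex and the closed sub-walk it
contains has non-negative weight (Lemma 24.10 ff., §24.1). This file proves the consequence used by
certificate verifiers that can only test signs of INTEGER combinations of the weights (mean-payoff
games over the additive reals, `Literature/Computability/Complexity/MPGSignVerifier.lean`):

* `walkWeight w L` — the weight `Σ w(Lᵢ, Lᵢ₊₁)` of a walk given as its vertex list `L`;
  `walkWeight_append_cons`, `walkWeight_append_singleton`, `walkWeight_eq_sum_walkPairs`
  (`walkPairs L` = the list of consecutive pairs, `length_walkPairs`);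
* `sub_le_walkWeight` — along an `E`-walk a feasible potential telescopes:
  `π(last) - π(first) ≤ walkWeight`; in particular closed walks have weight `≥ 0`;
* `exists_short_walk_le` — every `E`-walk is dominated (same endpoints, weight `≤`) by one with at
  most `|V|` vertices (pigeonhole + excision of a closed sub-walk);
* **`exists_shortWalkPotential`** — if some real potential is feasible then there are walks `P v`
  (ending at `v`, at most `|V|` vertices) with `walkWeight (P v) ≤ walkWeight (P u) + w(u, v)` on
  every edge: a feasible potential each of whose values is a sum of at most `|V| - 1` weights
  (with multiplicity), `sum_count_mul_eq_sum_map` rewriting such a sum as `Σᵢ countᵢ · wᵢ`.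

Weights are real (the only case needed); the relation `E` is arbitrary (no decidability used).

## References

* T. H. Cormen, C. E. Leiserson, R. L. Rivest, C. Stein, *Introduction to Algorithms*, 3rd ed.,
  MIT Press 2009, §24.4 (difference constraints and shortest paths, Thm 24.9), §24.1 and Lemma 24.10
  (shortest paths and negative-weight cycles). [CLRS2009]
-/

namespace Literature.Combinatorics.Optimization

variable {V : Type*}

/-! ### Walk weights -/

/-- The weight `w(L₀,L₁) + w(L₁,L₂) + ⋯` of a walk presented by its vertex list `L` (`0` for the
empty and the one-vertex list). [cite: CLRS2009, §24.1 (weight of a path)] -/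
def walkWeight (w : V → V → ℝ) : List V → ℝ
  | a :: b :: l => w a b + walkWeight w (b :: l)
  | _ => 0

/-- The list of consecutive pairs (edges traversed, with multiplicity) of a vertex list. [folklore] -/
def walkPairs : List V → List (V × V)
  | a :: b :: l => (a, b) :: walkPairs (b :: l)
  | _ => []

variable (w : V → V → ℝ)

/-- Empty walk. [folklore] -/
@[simp] theorem walkWeight_nil : walkWeight w [] = 0 := rfl

/-- One-vertex walk. [folklore] -/
@[simp] theorem walkWeight_singleton (a : V) : walkWeight w [a] = 0 := rfl

/-- First edge of a walk. [folklore] -/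
@[simp] theorem walkWeight_cons_cons (a b : V) (l : List V) :
    walkWeight w (a :: b :: l) = w a b + walkWeight w (b :: l) := rfl

/-- No pairs in the empty list. [folklore] -/
@[simp] theorem walkPairs_nil : walkPairs ([] : List V) = [] := rfl

/-- No pairs in a one-vertex list. [folklore] -/
@[simp] theorem walkPairs_singleton (a : V) : walkPairs [a] = [] := rfl

/-- First pair. [folklore] -/
@[simp] theorem walkPairs_cons_cons (a b : V) (l : List V) :
    walkPairs (a :: b :: l) = (a, b) :: walkPairs (b :: l) := rfl

/-- A vertex list with `m` vertices traverses `m - 1` edges. [folklore] -/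
theorem length_walkPairs : ∀ L : List V, (walkPairs L).length = L.length - 1
  | [] => rfl
  | [_] => rfl
  | a :: b :: l => by
    rw [walkPairs_cons_cons, List.length_cons, length_walkPairs (b :: l)]
    simp

/-- The weight of a walk is the sum of the weights of its consecutive pairs.
[cite: CLRS2009, §24.1 (weight of a path)] -/
theorem walkWeight_eq_sum_walkPairs : ∀ L : List V,
    walkWeight w L = ((walkPairs L).map fun p => w p.1 p.2).sum
  | [] => rfl
  | [_] => by simp
  | a :: b :: l => by
    rw [walkWeight_cons_cons, walkPairs_cons_cons, List.map_cons, List.sum_cons,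
      walkWeight_eq_sum_walkPairs (b :: l)]

/-- Splitting a walk at a vertex: the weight of `L₁ ++ x :: L₂` is that of `L₁ ++ [x]` plus that
of `x :: L₂`. [folklore] -/
theorem walkWeight_append_cons (x : V) (L₂ : List V) : ∀ L₁ : List V,
    walkWeight w (L₁ ++ x :: L₂) = walkWeight w (L₁ ++ [x]) + walkWeight w (x :: L₂)
  | [] => by simp
  | [a] => by simp
  | a :: b :: l => by
    have ih := walkWeight_append_cons x L₂ (b :: l)
    simp only [List.cons_append] at ih ⊢
    rw [walkWeight_cons_cons, walkWeight_cons_cons, ih, add_assoc]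

/-- Appending one edge `u → v` to a walk ending at `u` adds `w u v`. [folklore] -/
theorem walkWeight_append_singleton {u : V} (v : V) : ∀ {L : List V}, L.getLast? = some u →
    walkWeight w (L ++ [v]) = walkWeight w L + w u v
  | [], h => by simp at h
  | [a], h => by
    simp only [List.getLast?_singleton, Option.some.injEq] at h
    subst h
    simp
  | a :: b :: l, h => by
    have h' : (b :: l).getLast? = some u := by
      rw [← h, List.getLast?_cons_cons]
    have ih := walkWeight_append_singleton v h'
    simp only [List.cons_append] at ih ⊢
    rw [walkWeight_cons_cons, walkWeight_cons_cons, ih, add_assoc]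

/-! ### Feasible potentials telescope along walks -/

variable {w} {E : V → V → Prop} {π : V → ℝ}

/-- **Telescoping.** If `π(v) ≤ π(u) + w(u,v)` on every edge then along a walk `a, L` (an
`E`-chain from `a`) `π(end) - π(a) ≤ weight`. [cite: CLRS2009, §24.4 (proof of Thm 24.9)] -/
theorem sub_le_walkWeight (hπ : ∀ u v, E u v → π v ≤ π u + w u v) :
    ∀ (L : List V) (a : V), List.IsChain E (a :: L) → π (L.getLastD a) - π a ≤ walkWeight w (a :: L)
  | [], a, _ => by simp
  | b :: l, a, h => by
    rw [List.isChain_cons_cons] at h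
    have ih := sub_le_walkWeight hπ l b h.2
    have hab := hπ a b h.1
    rw [List.getLastD_cons, walkWeight_cons_cons]
    linarith

/-- Closed walks have non-negative weight under a feasible potential ("no negative cycle").
[cite: CLRS2009, Thm 24.9 (feasible ⇒ no negative-weight cycle)] -/
theorem walkWeight_nonneg_of_closed (hπ : ∀ u v, E u v → π v ≤ π u + w u v) (x : V) (B : List V)
    (h : List.IsChain E (x :: (B ++ [x]))) : 0 ≤ walkWeight w (x :: (B ++ [x])) := by
  have h1 := sub_le_walkWeight hπ (B ++ [x]) x h
  rw [List.getLastD_eq_getLast?, List.getLast?_append, List.getLast?_singleton,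
    Option.some_or, Option.getD_some, sub_self] at h1
  exact h1

/-! ### Short walks dominate -/

/-- A list over a finite type that is longer than the type repeats an entry, splitting as
`A ++ x :: B ++ x :: C`. [folklore] -/
theorem exists_split_of_card_lt_length [Fintype V] {L : List V} (h : Fintype.card V < L.length) :
    ∃ (x : V) (A B C : List V), L = A ++ x :: (B ++ x :: C) := by
  classical
  have hnd : ¬ L.Nodup := fun hnd => absurd (hnd.length_le_card) (not_le.2 h)
  rw [List.nodup_iff_sublist] at hnd
  push Not at hnd
  obtain ⟨x, hx⟩ := hnd
  obtain ⟨r₁, r₂, rfl, hx₁, hx₂⟩ := List.cons_sublist_iff.1 hx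
  obtain ⟨s, t, rfl⟩ := List.append_of_mem hx₁
  obtain ⟨s', t', rfl⟩ := List.append_of_mem (List.singleton_sublist.1 hx₂)
  exact ⟨x, s, t ++ s', t', by simp⟩

/-- **Every walk is dominated by a short one.** Under a feasible potential, for every non-empty
`E`-walk there is an `E`-walk with the same first and last vertex, at most `|V|` vertices, and no
larger weight (excise closed sub-walks, which have non-negative weight, until no vertex repeats).
[cite: CLRS2009, §24.1 and Lemma 24.10 ff. (shortest paths can be taken with ≤ |V| - 1 edges)] -/
theorem exists_short_walk_le [Fintype V] (hπ : ∀ u v, E u v → π v ≤ π u + w u v)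
    (L : List V) (hL : List.IsChain E L) (hne : L ≠ []) :
    ∃ L' : List V, List.IsChain E L' ∧ L' ≠ [] ∧ L'.head? = L.head? ∧
      L'.getLast? = L.getLast? ∧ L'.length ≤ Fintype.card V ∧ walkWeight w L' ≤ walkWeight w L := by
  suffices H : ∀ (m : ℕ) (L : List V), L.length = m → List.IsChain E L → L ≠ [] →
      ∃ L' : List V, List.IsChain E L' ∧ L' ≠ [] ∧ L'.head? = L.head? ∧
        L'.getLast? = L.getLast? ∧ L'.length ≤ Fintype.card V ∧ walkWeight w L' ≤ walkWeight w L from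
    H _ L rfl hL hne
  intro m
  induction m using Nat.strong_induction_on with
  | _ m ih =>
    intro L hm hL hne
    by_cases hlen : L.length ≤ Fintype.card V
    · exact ⟨L, hL, hne, rfl, rfl, hlen, le_rfl⟩
    · obtain ⟨x, A, B, C, rfl⟩ := exists_split_of_card_lt_length (not_le.1 hlen)
      have h1 := List.isChain_split.1 hL
      have h2 : List.IsChain E ((x :: B) ++ x :: C) := h1.2
      have h3 := List.isChain_split.1 h2
      have hL' : List.IsChain E (A ++ x :: C) := List.isChain_split.2 ⟨h1.1, h3.2⟩
      have hlt : (A ++ x :: C).length < m := by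
        rw [← hm]
        simp only [List.length_append, List.length_cons]
        omega
      obtain ⟨L', hc, hne', hh, hl, hlen', hw⟩ := ih _ hlt (A ++ x :: C) rfl hL' (by simp)
      refine ⟨L', hc, hne', ?_, ?_, hlen', ?_⟩
      · rw [hh, List.head?_append, List.head?_append]
        rfl
      · rw [hl, List.getLast?_append_of_ne_nil _ (List.cons_ne_nil _ _),
          List.getLast?_append_of_ne_nil _ (List.cons_ne_nil _ _), ← List.cons_append,
          List.getLast?_append_of_ne_nil _ (List.cons_ne_nil _ _)]
      · have hclosed : 0 ≤ walkWeight w (x :: (B ++ [x])) := walkWeight_nonneg_of_closed hπ x B h3.1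
        have e1 := walkWeight_append_cons w x (B ++ x :: C) A
        have e2 := walkWeight_append_cons w x C (x :: B)
        have e3 := walkWeight_append_cons w x C A
        simp only [List.cons_append] at e2
        rw [e2] at e1
        linarith

/-! ### Short-walk potentials -/

/-- **A feasible potential yields short-walk potentials.** If some real potential satisfies
`π(v) ≤ π(u) + w(u,v)` on every edge of `E` (a finite vertex type), then there is a family of
`E`-walks `P v`, the walk `P v` ending at `v` and having at most `|V|` vertices, whose weights form a
feasible potential: `walkWeight (P v) ≤ walkWeight (P u) + w(u,v)` on every edge (`P v` = a walk of
minimum weight among the `E`-walks with at most `|V|` vertices ending at `v`; such walks dominate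
all walks by `exists_short_walk_le`). This is the "shortest-path weights solve the difference
constraints" half of [CLRS2009, Thm 24.9], with the virtual source replaced by free starting points.
[cite: CLRS2009, Thm 24.9] -/
theorem exists_shortWalkPotential [Fintype V] (hπ : ∀ u v, E u v → π v ≤ π u + w u v) :
    ∃ P : V → List V, ∀ v : V, List.IsChain E (P v) ∧ (P v).getLast? = some v ∧
      (P v).length ≤ Fintype.card V ∧
      ∀ u : V, E u v → walkWeight w (P v) ≤ walkWeight w (P u) + w u v := by
  classical
  let S : V → Set (List V) := fun v =>
    {L | L.length ≤ Fintype.card V ∧ List.IsChain E L ∧ L.getLast? = some v}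
  have hfin : ∀ v, (S v).Finite := fun v =>
    (List.finite_length_le V (Fintype.card V)).subset fun L hL => hL.1
  have hne : ∀ v, (S v).Nonempty := fun v =>
    ⟨[v], Fintype.card_pos_iff.2 ⟨v⟩, List.isChain_singleton v, rfl⟩
  have hmin : ∀ v, ∃ L ∈ S v, ∀ L' ∈ S v, walkWeight w L ≤ walkWeight w L' := fun v =>
    Set.exists_min_image (S v) (walkWeight w) (hfin v) (hne v)
  choose P hP hPmin using hmin
  refine ⟨P, fun v => ⟨(hP v).2.1, (hP v).2.2, (hP v).1, fun u huv => ?_⟩⟩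
  -- extend the optimal walk to `u` by the edge `u → v` and dominate it by a short walk
  have hcat : List.IsChain E (P u ++ [v]) := by
    rw [List.isChain_append]
    refine ⟨(hP u).2.1, List.isChain_singleton v, fun a ha b hb => ?_⟩
    rw [(hP u).2.2] at ha
    simp only [Option.mem_def, Option.some.injEq, List.head?_cons] at ha hb
    subst ha; subst hb
    exact huv
  obtain ⟨L', hc, -, -, hl, hlen, hwt⟩ := exists_short_walk_le hπ (P u ++ [v]) hcat (by simp)
  have hL'S : L' ∈ S v := ⟨hlen, hc, by rw [hl]; simp⟩
  calc walkWeight w (P v) ≤ walkWeight w L' := hPmin v L' hL'S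
    _ ≤ walkWeight w (P u ++ [v]) := hwt
    _ = walkWeight w (P u) + w u v := walkWeight_append_singleton w v (hP u).2.2

/-! ### Walk weights as multiplicity combinations -/

/-- Regrouping a sum over a list by the multiplicities of its entries:
`Σ_{i ∈ s} count(i) · f i = Σ_{j ∈ L} f j` when `s` contains every entry of `L`. [folklore] -/
theorem sum_count_mul_eq_sum_map {ι : Type*} [DecidableEq ι] (s : Finset ι) (f : ι → ℝ) :
    ∀ L : List ι, (∀ i ∈ L, i ∈ s) → ∑ i ∈ s, (L.count i : ℝ) * f i = (L.map f).sum
  | [], _ => by simp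
  | a :: L, h => by
    have ih := sum_count_mul_eq_sum_map s f L fun i hi => h i (List.mem_cons_of_mem a hi)
    have ha : a ∈ s := h a List.mem_cons_self
    simp only [List.count_cons, Nat.cast_add, add_mul, Finset.sum_add_distrib, ih, List.map_cons,
      List.sum_cons]
    rw [add_comm]
    congr 1
    simp only [beq_iff_eq, Nat.cast_ite, Nat.cast_one, Nat.cast_zero, ite_mul, one_mul, zero_mul]
    rw [Finset.sum_ite_eq s a f, if_pos ha]

/-- Multiplicities of pairs in a short walk are small: an entry occurs at most `|L| - 1` times in
`walkPairs L`. [folklore] -/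
theorem count_walkPairs_le [DecidableEq V] (L : List V) (p : V × V) :
    (walkPairs L).count p ≤ L.length - 1 :=
  (List.count_le_length).trans (length_walkPairs L).le

end Literature.Combinatorics.Optimization
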